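import Mathlib
import Summits.ValiantsHypothesis.ValiantsHypothesis.Theorems.ElementaryWordLengthWordLengthQPStubMainAWAux

/-!
# Crux `WordLengthQP` (stmt-ValiantsHypothesis-6623), line `Sketch` (eps-order-ladder) —
stub `stub_mainAW`

The Allender–Wang cutting/finishing argument (Allender–Wang 2016, ECCC TR11-083, §3.3 Lemma 26,
Observations 29/33, Theorem 34; §4.1 Theorem 38) in the S-affine width-2 model, for an arbitrary
8-robust target `f` (degree `≥ 2` and top homogeneous part not a product of two positive-degree
polynomials after every assignment of constants to `≤ 8` variables), given the unit-determinant
case as a hypothesis (`hB`): no product of S-affine width-2 matrices between constant boundary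
matrices computes `f`.

* `mainAW_noGood` (Theorem I, "no good matrix"): if every cut of the program at a matrix with
  non-unit determinant is *bad* (every assignment making that matrix constant and singular makes
  the register row constant), the program does not compute a 4-robust polynomial — cut at the LAST
  such matrix, degenerate it with `≤ 4` variables, and finish with `hB`.
* `stub_mainAW` (Theorem II): otherwise take a good cut with the shortest prefix, shrink its
  witnessing assignment to the `≤ 4` variables of the cut matrix, split the program at the
  resulting constant rank-`≤ 1` matrix; robustness forces the suffix factor to be a constant,
  and Theorem I applies to the prefix program (its cuts are bad by minimality).
-/

-- `Summit.ValiantsHypothesis.ValiantsHypothesis.…` is the tree's mandated single-conjunct layout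
-- (Sub = Summit), so the duplicated namespace component is intended.
set_option linter.dupNamespace false

noncomputable section

open MvPolynomial

namespace Summit.ValiantsHypothesis.ValiantsHypothesis.Cruxes.WordLengthQP.EpsOrderLadder

set_option quotPrecheck false in
/-- `asg[Z, a]`: the assignment homomorphism `x_w ↦ a w` for `w ∈ Z`, `x_w ↦ x_w` otherwise. -/
local notation "asg[" Z ", " a "]" =>
  (MvPolynomial.aeval (fun w => if w ∈ Z then MvPolynomial.C (a w) else MvPolynomial.X (R := ℂ) w))

/-! ### Theorem I: programs all of whose degenerate cuts are bad -/

/-- **Theorem I** ("no good matrix"; AW16 Lemma 26 with the Cor. 37 finishing step): if `p` is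
4-robust and every cut of the program `(A, ms, B)` at a matrix with non-unit determinant is bad
(every assignment making that matrix constant and singular makes the register row after it
constant), then the program does not compute `p`. -/
theorem mainAW_noGood {σ : Type} [DecidableEq σ] (p : MvPolynomial σ ℂ)
    (hp : ∀ (Z : Finset σ) (a : σ → ℂ), Z.card ≤ 4 → ∀ f' : MvPolynomial σ ℂ,
      f' = asg[Z, a] p →
      2 ≤ f'.totalDegree ∧ ¬ ∃ g h : MvPolynomial σ ℂ, 0 < g.totalDegree ∧ 0 < h.totalDegree ∧
        homogeneousComponent f'.totalDegree f' = g * h)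
    (hB : ∀ (ms : List (Matrix (Fin 2) (Fin 2) (MvPolynomial σ ℂ)))
      (A B : Matrix (Fin 2) (Fin 2) ℂ),
      (∀ m ∈ ms, (∀ i j : Fin 2, (∃ b : ℂ, m i j = C b) ∨
          (∃ (a b : ℂ) (v : σ), m i j = C a * X v + C b)) ∧
        ∃ d : ℂ, d ≠ 0 ∧ m.det = C d) →
      ∀ f' : MvPolynomial σ ℂ,
        f' = ((A.map (C (σ := σ) (R := ℂ))) * ms.prod * (B.map (C (σ := σ) (R := ℂ)))) 0 0 →
        f'.totalDegree ≤ 1 ∨ ∃ g h : MvPolynomial σ ℂ, 0 < g.totalDegree ∧ 0 < h.totalDegree ∧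
          homogeneousComponent f'.totalDegree f' = g * h)
    (A B : Matrix (Fin 2) (Fin 2) ℂ) (ms : List (Matrix (Fin 2) (Fin 2) (MvPolynomial σ ℂ)))
    (hS : ∀ m ∈ ms, ∀ i j : Fin 2, (∃ b : ℂ, m i j = C b) ∨
      (∃ (a b : ℂ) (v : σ), m i j = C a * X v + C b))
    (hBad : ∀ (pre : List (Matrix (Fin 2) (Fin 2) (MvPolynomial σ ℂ)))
      (m : Matrix (Fin 2) (Fin 2) (MvPolynomial σ ℂ))
      (suf : List (Matrix (Fin 2) (Fin 2) (MvPolynomial σ ℂ))),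
      ms = pre ++ m :: suf → (¬ ∃ d : ℂ, d ≠ 0 ∧ m.det = C d) →
      ∀ (Z : Finset σ) (a : σ → ℂ), (∀ i j : Fin 2, ∃ c : ℂ, asg[Z, a] (m i j) = C c) →
        asg[Z, a] m.det = 0 → ∀ j : Fin 2, ∃ κ : ℂ,
          ((A.map (C (σ := σ) (R := ℂ))) * (pre.map (fun m' => m'.map asg[Z, a])).prod *
            m.map asg[Z, a]) 0 j = C κ) :
    ((A.map (C (σ := σ) (R := ℂ))) * ms.prod * (B.map (C (σ := σ) (R := ℂ)))) 0 0 ≠ p := by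
  intro hval
  rcases mainAW_split_last (fun m : Matrix (Fin 2) (Fin 2) (MvPolynomial σ ℂ) =>
      ∃ d : ℂ, d ≠ 0 ∧ m.det = C d) ms with hall | ⟨pre, m, suf, hms, hm, hsuf⟩
  · -- every matrix has unit determinant: `hB` applies to the program itself
    have hr := hp ∅ (fun _ => 0) (by simp) p (mainAW_asg_empty _ p).symm
    have h2 := hr.1
    rcases hB ms A B (fun m hm => ⟨hS m hm, hall m hm⟩) p hval.symm with h1 | h1
    · omega
    · exact hr.2 h1
  · -- the LAST matrix with non-unit determinant degenerates under an assignment of `≤ 4`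
    -- variables; the cut there is bad, so the register row after it is a constant row `κ`
    obtain ⟨Z, a, hZ, hc, hdet⟩ := mainAW_degen m (hS m (by rw [hms]; simp)) hm
    choose κ hκ using hBad pre m suf hms hm Z a hc hdet
    have hval' : asg[Z, a] p =
        (((!![κ 0, κ 1; 0, 0] : Matrix (Fin 2) (Fin 2) ℂ).map (C (σ := σ) (R := ℂ))) *
          (suf.map (fun m' => m'.map asg[Z, a])).prod * (B.map (C (σ := σ) (R := ℂ)))) 0 0 := by
      rw [← hval, mainAW_val_map, hms, List.map_append, List.map_cons, List.prod_append,
        List.prod_cons]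
      have hassoc : ∀ P Q M S T : Matrix (Fin 2) (Fin 2) (MvPolynomial σ ℂ),
          P * (Q * (M * S)) * T = P * Q * M * (S * T) := by
        intro P Q M S T
        simp only [Matrix.mul_assoc]
      rw [hassoc, mainAW_val_constRow _ _ _ κ hκ]
      simp only [Matrix.mul_assoc]
    -- the suffix has unit determinants, so `hB` finishes
    have hr := hp Z a hZ _ rfl
    have h2 := hr.1
    have hsuf' : ∀ m' ∈ suf.map (fun m' => m'.map asg[Z, a]),
        (∀ i j : Fin 2, (∃ b : ℂ, m' i j = C b) ∨
          (∃ (a b : ℂ) (v : σ), m' i j = C a * X v + C b)) ∧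
        ∃ d : ℂ, d ≠ 0 ∧ m'.det = C d := by
      intro m' hm'
      obtain ⟨m₀, hm₀, rfl⟩ := List.mem_map.1 hm'
      exact ⟨mainAW_saff_map Z a m₀ (hS m₀ (by rw [hms]; simp [hm₀])),
        mainAW_indg_map _ m₀ (hsuf m₀ hm₀)⟩
    rcases hB _ _ B hsuf' _ hval' with h1 | h1
    · omega
    · exact hr.2 h1

/-! ### Theorem II: the stub -/

/-- **stub_mainAW** (AW16 Lemma 26, Observations 29/33, Theorem 34 — the cutting/finishing
argument, S-model, for an arbitrary 8-robust target): if `f` has degree `≥ 2` and top homogeneous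
part not a product of two positive-degree polynomials after every assignment of constants to at
most `8` variables, and if every product of S-affine width-2 matrices with UNIT determinants and
constant boundary matrices computes a polynomial of degree `≤ 1` or with reducible top part, then
no product of S-affine width-2 matrices with constant boundary matrices computes `f`. -/
theorem stub_mainAW {σ : Type} [Fintype σ] [DecidableEq σ] (f : MvPolynomial σ ℂ)
    (hrob : ∀ (Z : Finset σ) (a : σ → ℂ), Z.card ≤ 8 → ∀ f' : MvPolynomial σ ℂ,
      f' = MvPolynomial.aeval
        (fun v : σ => if v ∈ Z then MvPolynomial.C (a v) else MvPolynomial.X v) f →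
      2 ≤ f'.totalDegree ∧ ¬ ∃ g h : MvPolynomial σ ℂ, 0 < g.totalDegree ∧ 0 < h.totalDegree ∧
        MvPolynomial.homogeneousComponent f'.totalDegree f' = g * h)
    (hB : ∀ (ms : List (Matrix (Fin 2) (Fin 2) (MvPolynomial σ ℂ))) (A B : Matrix (Fin 2) (Fin 2) ℂ),
      (∀ m ∈ ms, (∀ i j : Fin 2, (∃ b : ℂ, m i j = MvPolynomial.C b) ∨
          (∃ (a b : ℂ) (v : σ), m i j = MvPolynomial.C a * MvPolynomial.X v + MvPolynomial.C b)) ∧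
        ∃ d : ℂ, d ≠ 0 ∧ m.det = MvPolynomial.C d) →
      ∀ f' : MvPolynomial σ ℂ,
        f' = ((A.map (MvPolynomial.C (σ := σ) (R := ℂ))) * ms.prod *
          (B.map (MvPolynomial.C (σ := σ) (R := ℂ)))) 0 0 →
        f'.totalDegree ≤ 1 ∨ ∃ g h : MvPolynomial σ ℂ, 0 < g.totalDegree ∧ 0 < h.totalDegree ∧
          MvPolynomial.homogeneousComponent f'.totalDegree f' = g * h)
    (ms : List (Matrix (Fin 2) (Fin 2) (MvPolynomial σ ℂ)))
    (hS : ∀ m ∈ ms, ∀ i j : Fin 2, (∃ b : ℂ, m i j = MvPolynomial.C b) ∨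
      (∃ (a b : ℂ) (v : σ), m i j = MvPolynomial.C a * MvPolynomial.X v + MvPolynomial.C b))
    (A B : Matrix (Fin 2) (Fin 2) ℂ) :
    ((A.map (MvPolynomial.C (σ := σ) (R := ℂ))) * ms.prod *
      (B.map (MvPolynomial.C (σ := σ) (R := ℂ)))) 0 0 ≠ f := by
  intro hval
  by_cases hgood : ∃ (pre : List (Matrix (Fin 2) (Fin 2) (MvPolynomial σ ℂ)))
      (m : Matrix (Fin 2) (Fin 2) (MvPolynomial σ ℂ))
      (suf : List (Matrix (Fin 2) (Fin 2) (MvPolynomial σ ℂ))),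
      ms = pre ++ m :: suf ∧ ((¬ ∃ d : ℂ, d ≠ 0 ∧ m.det = C d) ∧
        ¬ ∀ (Z : Finset σ) (a : σ → ℂ), (∀ i j : Fin 2, ∃ c : ℂ, asg[Z, a] (m i j) = C c) →
          asg[Z, a] m.det = 0 → ∀ j : Fin 2, ∃ κ : ℂ,
            ((A.map (C (σ := σ) (R := ℂ))) * (pre.map (fun m' => m'.map asg[Z, a])).prod *
              m.map asg[Z, a]) 0 j = C κ)
  swap
  · -- every cut at a matrix with non-unit determinant is bad: Theorem I applies to `f` itself
    refine mainAW_noGood f (mainAW_robust_transfer f 8 4 hrob ∅ (fun _ => 0) (by simp) f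
      (mainAW_asg_empty _ f).symm) hB A B ms hS (fun pre m suf hms hm => ?_) hval
    by_contra hb
    exact hgood ⟨pre, m, suf, hms, hm, hb⟩
  -- a GOOD cut exists; take one with the shortest prefix
  obtain ⟨pre, m, suf, hms, ⟨hm, hnotbad⟩, hmin⟩ := mainAW_split_min _ ms hgood
  push Not at hnotbad
  obtain ⟨Z, a, hc, hdet, j, hj⟩ := hnotbad
  -- shrink the witnessing assignment to the `≤ 4` variables `V` of `m`
  have hSm : ∀ i j : Fin 2, (∃ b : ℂ, m i j = C b) ∨
      (∃ (a b : ℂ) (v : σ), m i j = C a * X v + C b) := hS m (by rw [hms]; simp)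
  obtain ⟨V, hV, hmV⟩ := mainAW_vars4 m hSm
  have hZ' : (Z ∩ V).card ≤ 4 := (Finset.card_le_card Finset.inter_subset_right).trans hV
  have hshrink : m.map asg[Z ∩ V, a] = m.map asg[Z, a] := mainAW_asg_shrink V Z a m hmV
  have hc' : ∀ i k : Fin 2, ∃ c : ℂ, asg[Z ∩ V, a] (m i k) = C c := by
    intro i k
    obtain ⟨c, hck⟩ := hc i k
    refine ⟨c, ?_⟩
    have hik := congrFun (congrFun hshrink i) k
    rw [Matrix.map_apply, Matrix.map_apply] at hik
    rw [hik]
    exact hck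
  have hdet' : asg[Z ∩ V, a] m.det = 0 := by
    rw [← mainAW_det_map, hshrink, mainAW_det_map]
    exact hdet
  -- the register row after `m` under the shrunk assignment is still non-constant
  have hj' : ∀ κ : ℂ, ((A.map (C (σ := σ) (R := ℂ))) *
      (pre.map (fun m' => m'.map asg[Z ∩ V, a])).prod * m.map asg[Z ∩ V, a]) 0 j ≠ C κ := by
    intro κ hκ
    apply hj κ
    rw [← mainAW_row_absorb (Z ∩ V) Z Finset.inter_subset_left a A pre m j, hκ, mainAW_hom_C]
  -- under the shrunk assignment `m` becomes a constant singular matrix `N = u vᵀ`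
  obtain ⟨N, hN⟩ := mainAW_constMat asg[Z ∩ V, a] m hc'
  have hNdet : N.det = 0 := by
    have h1 : (m.map asg[Z ∩ V, a]).det = C N.det := by
      rw [hN, ← RingHom.mapMatrix_apply, ← RingHom.map_det]
    rw [mainAW_det_map, hdet'] at h1
    simpa using h1.symm
  obtain ⟨u, v, huv⟩ := mainAW_rank1 N hNdet
  -- the two halves `g`, `h` of the program cut at `N`
  obtain ⟨g, hg_def⟩ : ∃ g : MvPolynomial σ ℂ, g = ((A.map (C (σ := σ) (R := ℂ))) *
      (pre.map (fun m' => m'.map asg[Z ∩ V, a])).prod *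
      (!![u 0, 0; u 1, 0] : Matrix (Fin 2) (Fin 2) ℂ).map (C (σ := σ) (R := ℂ))) 0 0 := ⟨_, rfl⟩
  obtain ⟨h, hh_def⟩ : ∃ h : MvPolynomial σ ℂ, h =
      ((!![v 0, v 1; 0, 0] : Matrix (Fin 2) (Fin 2) ℂ).map (C (σ := σ) (R := ℂ)) *
        (suf.map (fun m' => m'.map asg[Z ∩ V, a])).prod * (B.map (C (σ := σ) (R := ℂ)))) 0 0 :=
    ⟨_, rfl⟩
  have hfact : asg[Z ∩ V, a] f = g * h := by
    rw [hg_def, hh_def, ← hval, mainAW_val_map, hms, List.map_append, List.map_cons, hN]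
    exact mainAW_val_split A B N u v huv _ _
  have hrow : ((A.map (C (σ := σ) (R := ℂ))) *
      (pre.map (fun m' => m'.map asg[Z ∩ V, a])).prod * m.map asg[Z ∩ V, a]) 0 j =
      g * C (v j) := by
    rw [hg_def, hN]
    exact mainAW_split_row N u v huv _ j
  -- `g` is non-constant since the register row is
  have hg : 0 < g.totalDegree := by
    rw [pos_iff_ne_zero]
    intro h0
    rw [totalDegree_eq_zero_iff_eq_C] at h0
    apply hj' (coeff 0 g * v j)
    rw [hrow, map_mul, ← h0]
  -- robustness of the assigned target: `h` must be a constant `κ`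
  have hr := hrob (Z ∩ V) a (by omega) _ rfl
  rcases mainAW_key_factor _ g h hr.1 hr.2 hfact with hg0 | hh0
  · omega
  rw [totalDegree_eq_zero_iff_eq_C] at hh0
  obtain ⟨κ, hhκ⟩ : ∃ κ : ℂ, h = C κ := ⟨_, hh0⟩
  -- so the assigned target is computed by the PREFIX program with boundary `κ • U`
  have hp : ((A.map (C (σ := σ) (R := ℂ))) * (pre.map (fun m' => m'.map asg[Z ∩ V, a])).prod *
      ((κ • (!![u 0, 0; u 1, 0] : Matrix (Fin 2) (Fin 2) ℂ)).map (C (σ := σ) (R := ℂ)))) 0 0 =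
      asg[Z ∩ V, a] f := by
    rw [mainAW_val_smul, hfact, hhκ, mul_comm, hg_def]
  -- Theorem I for the prefix program: its cuts are bad by minimality (and AW16 Obs. 33)
  have key := mainAW_noGood (asg[Z ∩ V, a] f)
    (mainAW_robust_transfer f 8 4 hrob (Z ∩ V) a (by omega) _ rfl) hB A
    (κ • (!![u 0, 0; u 1, 0] : Matrix (Fin 2) (Fin 2) ℂ))
    (pre.map (fun m' => m'.map asg[Z ∩ V, a]))
  refine key (fun m' hm' => ?_) (fun P₁ M P₂ hsplit hM => ?_) hp
  · obtain ⟨m₀, hm₀, rfl⟩ := List.mem_map.1 hm'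
    exact mainAW_saff_map _ a m₀ (hS m₀ (by rw [hms]; simp [hm₀]))
  · obtain ⟨pre₁, m₁, pre₂, hpre, hP₁, hM₁, -⟩ := mainAW_map_split _ pre P₁ M P₂ hsplit
    subst hP₁ hM₁
    have hm₁ : ¬ ∃ d : ℂ, d ≠ 0 ∧ m₁.det = C d := fun h₁ => hM (mainAW_indg_map _ m₁ h₁)
    refine mainAW_bad_map A pre₁ m₁ (Z ∩ V) a ?_
    by_contra hb
    have hmin₁ := hmin pre₁ m₁ pre₂ hpre
    beta_reduce at hmin₁
    exact hmin₁ ⟨hm₁, hb⟩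

end Summit.ValiantsHypothesis.ValiantsHypothesis.Cruxes.WordLengthQP.EpsOrderLadder
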